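import Summits.CriticalPhenomena.PercolationContinuityZ3.Theorems.PercNearOneGluingNoHeavyLowerTailFrontierDecRowsClusterBHK3Defs
import Summits.CriticalPhenomena.PercolationContinuityZ3.Theorems.PercNearOneGluingNoHeavyLowerTailCovTriangleGPlusIdentity
import HarnessLib

/-!
# `NoHeavyLowerTail` (stmt-CriticalPhenomena-4575) — Conjecture G⁺ (`ClusterBHK3Pos`) IS the quantitative BHK inequality (kernel equivalence)

Support file (prover prim-facecert gen 11; `--supports stmt-CriticalPhenomena-4575`).  No definitions, no named facts, no sorries.

With `D = {S ↮ T}`, `U = Dᶜ`, `μ = prodBernoulli w`, prim-ineq-prove-3's Conjecture G⁺ (`FrontierDecRows.ClusterBHK3Pos`: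
`0 ≤ E₃(D, Aᶜ, Bᶜ)` for `A` cluster-monotone in `C_S` and `B` cluster-monotone in `C_T`) is EQUIVALENT to

  `QuantBHK`:  `μ(D∩A)μ(D∩B) − μ(D)μ(D∩A∩B)  ≤  μ(D)·[μ(U)μ(Aᶜ∩Bᶜ) − μ(U∩(Aᶜ∩Bᶜ))] + Cov(U,A)·Cov(U,B)`

for the same class of `(S,T,A,B)` (`clusterBHK3Pos_iff_quantBHK`, from the exact identity `CovTrianglePath.sahiE3_compl_mul_eq`).  On this class
every term is a nonnegative THEOREM (`quantBHK_terms_nonneg`: the left side is the van den Berg–Häggström–Kahn deficit `≥ 0` by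
`setTwoClusterExchange`; `H' ≥ 0` and the two covariances `≥ 0` by Harris), so G⁺ asks precisely that the BHK negative-dependence deficit of
`(A,B)` given `{S ↮ T}` be dominated by `μ(D)`·(Harris slack of `{S~T}` against `Aᶜ∩Bᶜ`) plus the product of the Harris slacks of `{S~T}`
against `A` and `B`.  (The weaker inequality with `2·deficit` room is the covariance triangle, an unconditional theorem:
`CovTrianglePath.covTriangle_typed`; `covTriangleExpr_eq_three_terms` below writes it as `Δ* + μ(D)·H' + Cov·Cov`, a sum of three
nonnegative theorem terms.)
-/

noncomputable section

namespace Summit.CriticalPhenomena.PercolationContinuityZ3.Theorems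

namespace CovTrianglePath

open MeasureTheory Set
open Literature.Probability.LatticeModels (sahiE3)

/-- **CT is the sum of three signed theorem terms**: for every probability measure,
`μ(D∩Bᶜ)·Cov(U,A) + μ(D∩Aᶜ)·Cov(U,B) − μ(D)²·Cov(A,B) = Δ* + μ(D)·H' + Cov(U,A)·Cov(U,B)` (`D = Uᶜ`).  In percolation each summand is
`≥ 0` (BHK two-set row, Harris(up,down), Harris × Harris) — this is the whole content of the covariance triangle, while G⁺ flips the sign of
`Δ*`. [this work] -/
theorem covTriangleExpr_eq_three_terms {Ω : Type*} [MeasurableSpace Ω] (μ : Measure Ω) [IsProbabilityMeasure μ] {U A B : Set Ω}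
    (hU : MeasurableSet U) (hA : MeasurableSet A) (hB : MeasurableSet B) :
    μ.real (Uᶜ ∩ Bᶜ) * (μ.real (U ∩ A) - μ.real U * μ.real A) +
        μ.real (Uᶜ ∩ Aᶜ) * (μ.real (U ∩ B) - μ.real U * μ.real B) -
        μ.real Uᶜ ^ 2 * (μ.real (A ∩ B) - μ.real A * μ.real B) =
      (μ.real (Uᶜ ∩ A) * μ.real (Uᶜ ∩ B) - μ.real Uᶜ * μ.real (Uᶜ ∩ A ∩ B)) +
        μ.real Uᶜ * (μ.real U * μ.real (Aᶜ ∩ Bᶜ) - μ.real (U ∩ (Aᶜ ∩ Bᶜ))) +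
        (μ.real (U ∩ A) - μ.real U * μ.real A) * (μ.real (U ∩ B) - μ.real U * μ.real B) := by
  rw [covTriangleExpr_eq μ hU hA hB, sahiE3_compl_mul_eq μ hU hA hB]
  ring

end CovTrianglePath

namespace FrontierDecRows

open MeasureTheory Set
open Literature.Probability.Percolation Literature.Probability.LatticeModels
open CovTrianglePath

/-- **G⁺ ⟺ quantitative BHK** (kernel equivalence of the two conjecture forms; see the file docstring). [this work] -/
theorem clusterBHK3Pos_iff_quantBHK :
    ClusterBHK3Pos ↔
      ∀ (n : ℕ) (w : Sym2 (Fin n) → unitInterval) (S T : Set (Fin n)) (A B : Set (BondConfig (Fin n))),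
        (∀ ⦃ω ω' : BondConfig (Fin n)⦄,
            (⋃ s ∈ S, openEdgeCluster ω s) ⊆ (⋃ s ∈ S, openEdgeCluster ω' s) → ω ∈ A → ω' ∈ A) →
        (∀ ⦃ω ω' : BondConfig (Fin n)⦄,
            (⋃ t ∈ T, openEdgeCluster ω t) ⊆ (⋃ t ∈ T, openEdgeCluster ω' t) → ω ∈ B → ω' ∈ B) →
        (prodBernoulli w).real ({ω : BondConfig (Fin n) | ∀ s ∈ S, ∀ t ∈ T, ¬ (openGraph ω).Reachable s t} ∩ A) *
            (prodBernoulli w).real ({ω : BondConfig (Fin n) | ∀ s ∈ S, ∀ t ∈ T, ¬ (openGraph ω).Reachable s t} ∩ B) -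
          (prodBernoulli w).real {ω : BondConfig (Fin n) | ∀ s ∈ S, ∀ t ∈ T, ¬ (openGraph ω).Reachable s t} *
            (prodBernoulli w).real ({ω : BondConfig (Fin n) | ∀ s ∈ S, ∀ t ∈ T, ¬ (openGraph ω).Reachable s t} ∩ A ∩ B) ≤
        (prodBernoulli w).real {ω : BondConfig (Fin n) | ∀ s ∈ S, ∀ t ∈ T, ¬ (openGraph ω).Reachable s t} *
            ((prodBernoulli w).real {ω : BondConfig (Fin n) | ∀ s ∈ S, ∀ t ∈ T, ¬ (openGraph ω).Reachable s t}ᶜ *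
                (prodBernoulli w).real (Aᶜ ∩ Bᶜ) -
              (prodBernoulli w).real ({ω : BondConfig (Fin n) | ∀ s ∈ S, ∀ t ∈ T, ¬ (openGraph ω).Reachable s t}ᶜ ∩ (Aᶜ ∩ Bᶜ))) +
          ((prodBernoulli w).real ({ω : BondConfig (Fin n) | ∀ s ∈ S, ∀ t ∈ T, ¬ (openGraph ω).Reachable s t}ᶜ ∩ A) -
              (prodBernoulli w).real {ω : BondConfig (Fin n) | ∀ s ∈ S, ∀ t ∈ T, ¬ (openGraph ω).Reachable s t}ᶜ *
                (prodBernoulli w).real A) *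
            ((prodBernoulli w).real ({ω : BondConfig (Fin n) | ∀ s ∈ S, ∀ t ∈ T, ¬ (openGraph ω).Reachable s t}ᶜ ∩ B) -
              (prodBernoulli w).real {ω : BondConfig (Fin n) | ∀ s ∈ S, ∀ t ∈ T, ¬ (openGraph ω).Reachable s t}ᶜ *
                (prodBernoulli w).real B) := by
  constructor
  · intro hG n w S T A B hA hB
    set D : Set (BondConfig (Fin n)) := {ω : BondConfig (Fin n) | ∀ s ∈ S, ∀ t ∈ T, ¬ (openGraph ω).Reachable s t} with hD
    have h0 := hG n w S T A B hA hB
    rw [← hD] at h0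
    have key := quantBHK_of_sahiE3_nonneg (prodBernoulli w) (U := Dᶜ) (A := A) (B := B)
      MeasurableSet.of_discrete MeasurableSet.of_discrete MeasurableSet.of_discrete (by rw [compl_compl]; exact h0)
    rw [compl_compl] at key
    exact key
  · intro hQ n w S T A B hA hB
    set D : Set (BondConfig (Fin n)) := {ω : BondConfig (Fin n) | ∀ s ∈ S, ∀ t ∈ T, ¬ (openGraph ω).Reachable s t} with hD
    have h0 := hQ n w S T A B hA hB
    rw [← hD] at h0
    have key := sahiE3_nonneg_of_quantBHK (prodBernoulli w) (U := Dᶜ) (A := A) (B := B)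
      MeasurableSet.of_discrete MeasurableSet.of_discrete MeasurableSet.of_discrete (by rw [compl_compl]; exact h0)
    rw [compl_compl] at key
    exact key

/-- **Every term of QuantBHK is a nonnegative theorem on the G⁺ class.**  For `A` cluster-monotone in `C_S` and `B` cluster-monotone in `C_T`
(`D = {S ↮ T}`):  `0 ≤ μ(D∩A)μ(D∩B) − μ(D)μ(D∩A∩B)` (BHK, `setTwoClusterExchange`),  `μ(Dᶜ∩(Aᶜ∩Bᶜ)) ≤ μ(Dᶜ)μ(Aᶜ∩Bᶜ)`,
`μ(Dᶜ)μ(A) ≤ μ(Dᶜ∩A)`, `μ(Dᶜ)μ(B) ≤ μ(Dᶜ∩B)` (Harris). [this work] -/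
theorem quantBHK_terms_nonneg {n : ℕ} (w : Sym2 (Fin n) → unitInterval) (S T : Set (Fin n)) {A B : Set (BondConfig (Fin n))}
    (hA : ∀ ⦃ω ω' : BondConfig (Fin n)⦄,
        (⋃ s ∈ S, openEdgeCluster ω s) ⊆ (⋃ s ∈ S, openEdgeCluster ω' s) → ω ∈ A → ω' ∈ A)
    (hB : ∀ ⦃ω ω' : BondConfig (Fin n)⦄,
        (⋃ t ∈ T, openEdgeCluster ω t) ⊆ (⋃ t ∈ T, openEdgeCluster ω' t) → ω ∈ B → ω' ∈ B) :
    0 ≤ (prodBernoulli w).real ({ω : BondConfig (Fin n) | ∀ s ∈ S, ∀ t ∈ T, ¬ (openGraph ω).Reachable s t} ∩ A) *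
          (prodBernoulli w).real ({ω : BondConfig (Fin n) | ∀ s ∈ S, ∀ t ∈ T, ¬ (openGraph ω).Reachable s t} ∩ B) -
        (prodBernoulli w).real {ω : BondConfig (Fin n) | ∀ s ∈ S, ∀ t ∈ T, ¬ (openGraph ω).Reachable s t} *
          (prodBernoulli w).real ({ω : BondConfig (Fin n) | ∀ s ∈ S, ∀ t ∈ T, ¬ (openGraph ω).Reachable s t} ∩ A ∩ B) ∧
      (prodBernoulli w).real ({ω : BondConfig (Fin n) | ∀ s ∈ S, ∀ t ∈ T, ¬ (openGraph ω).Reachable s t}ᶜ ∩ (Aᶜ ∩ Bᶜ)) ≤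
        (prodBernoulli w).real {ω : BondConfig (Fin n) | ∀ s ∈ S, ∀ t ∈ T, ¬ (openGraph ω).Reachable s t}ᶜ *
          (prodBernoulli w).real (Aᶜ ∩ Bᶜ) ∧
      (prodBernoulli w).real {ω : BondConfig (Fin n) | ∀ s ∈ S, ∀ t ∈ T, ¬ (openGraph ω).Reachable s t}ᶜ * (prodBernoulli w).real A ≤
        (prodBernoulli w).real ({ω : BondConfig (Fin n) | ∀ s ∈ S, ∀ t ∈ T, ¬ (openGraph ω).Reachable s t}ᶜ ∩ A) ∧
      (prodBernoulli w).real {ω : BondConfig (Fin n) | ∀ s ∈ S, ∀ t ∈ T, ¬ (openGraph ω).Reachable s t}ᶜ * (prodBernoulli w).real B ≤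
        (prodBernoulli w).real ({ω : BondConfig (Fin n) | ∀ s ∈ S, ∀ t ∈ T, ¬ (openGraph ω).Reachable s t}ᶜ ∩ B) := by
  set D : Set (BondConfig (Fin n)) := {ω : BondConfig (Fin n) | ∀ s ∈ S, ∀ t ∈ T, ¬ (openGraph ω).Reachable s t} with hD
  obtain ⟨hAup, hAtyp⟩ := (clusterMono_iff_isUpperSet_and_typePlus S T A).mp hA
  obtain ⟨hBup, hBtyp⟩ := (clusterMono_iff_isUpperSet_and_typePlus T S B).mp hB
  have hDup : IsUpperSet Dᶜ := (CovTrianglePath.isLowerSet_sepSet (V := Fin n) S T).compl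
  refine ⟨?_, ?_, ?_, ?_⟩
  · have hts := setTwoClusterExchange w S T (A₁ := A) (A₂ := Set.univ) (B₁ := B) (B₂ := Set.univ)
      hAtyp (fun _ _ _ _ _ => Set.mem_univ _) (fun ω ω' h1 h2 hω => hBtyp h2 h1 hω) (fun _ _ _ _ _ => Set.mem_univ _)
    rw [← hD] at hts
    simp only [Set.inter_univ] at hts
    rw [Set.inter_assoc]
    linarith [hts]
  · exact prodBernoulli_harris_upper_lower w hDup (hAup.compl.inter hBup.compl) MeasurableSet.of_discrete MeasurableSet.of_discrete
  · exact prodBernoulli_harris w hDup hAup MeasurableSet.of_discrete MeasurableSet.of_discrete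
  · exact prodBernoulli_harris w hDup hBup MeasurableSet.of_discrete MeasurableSet.of_discrete

end FrontierDecRows

end Summit.CriticalPhenomena.PercolationContinuityZ3.Theorems
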